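import Literature.AnabelianGeometry.AbsoluteAnabelian.AbsTopI.ChainTransport
import Literature.AnabelianGeometry.AbsoluteAnabelian.FundamentalExtensionNonVacuity
import Literature.AnabelianGeometry.AbsoluteAnabelian.SlimTransport
import Literature.AnabelianGeometry.SemiGraphs.TemperedCurveGroupLevelDataNonVacuity2
import HarnessLib

/-!
# [AbsTopI] Def 4.2 (iii) / Thm 4.7: the interfaces `AbsTopI.TargetData` and `AbsTopI.SchemeChains`
# are inhabited — §4(iii) NON-VACUITY witnesses (abc-iut-w5-d197, gen 2)

S. Mochizuki, *Topics in absolute anabelian geometry I: generalities*, J. Math. Sci. Univ. Tokyo 19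
(2012) [AbsTopI], Def 4.2 (iii) p. 49 (the slimness inputs (0_Π)–(2_Π) of a `Π`-chain: "`Π` slim,
`Δ` slim, `Δ ≠ {1}`") and Rmk 4.2.1 p. 51 / Thm 4.7 (i) p. 57 (the scheme side `Chain(X̃/X) → Chain(Π)`),
typed by abc-iut-L4-t4 as the binder package `AbsTopI.TargetData F` (`ChainTransport.lean`) and the
interface `AbsTopI.SchemeChains E C hP hΔ hne` (`SemiAbsoluteChains.lean`).  Both rows read ZERO
producers in the L4 inhabitation census v2 (abc-iut-w5-d197, 05:58Z).  This PROOF-ONLY file (no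
`def`/`instance`/`structure`; witnesses inside theorem terms) records:

* `AbsTopI.TargetData.nonempty_iff` — the EXACT criterion: `TargetData F` is inhabited iff `Π_F` is slim,
  `Δ_F` is slim and `Δ_F ≠ 1` (cuspidal data always exist: abc-iut-L4's `CuspidalData.nonempty_cuspless`).
* `AbsTopI.TargetData.exists_slim_prod` — a GENUINE-IN-GROUP-THEORY instance over `ℚ_p`:
  `Π := G_{ℚ_p} × F̂₂ ↠ G := G_{ℚ_p}` (first projection), `Δ = 1 × F̂₂ ≃ₜ* F̂₂ ≠ 1`.  Slimness of `Π` is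
  the product of two KERNEL theorems of the tree — `G_{ℚ_p}` slim ([pGC] Lemma 15.8, PROVED:
  `IsSubpadicFor.isSlimGroup_absoluteGaloisGroup`, abc-iut-L4-d2) and `F̂₂` slim
  (`isSlimGroup_profiniteCompletion_freeGroupTwo`, abc-iut-w5-d040 / abc-iut-w5-d218) — via
  `isSlimGroup_prod_of_profinite`; slimness of `Δ` is transported along `F̂₂ ≃ₜ* Δ`
  (`isSlimGroup_of_continuousMulEquiv`).  HONEST LABEL: a direct product, not the étale fundamental
  group of a hyperbolic orbicurve over `ℚ_p` (no such `π₁` is constructed in the tree); it shows the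
  binder package (0_Π)–(2_Π) is jointly satisfiable with a genuine arithmetic quotient `G_{ℚ_p}` and a
  non-abelian free profinite `Δ`.
* `AbsTopI.SchemeChains.nonempty` — over EVERY `(E, C, hP, hΔ, hne)`: the interface of Rmk 4.2.1 is
  inhabited by the ONE-OBJECT scheme side `{X}` (the trivial `X̃/X`-chain of length `0`) mapped to the
  trivial `Π`-chain `Π₀ = Π`, with the identity as its only (terminal) (iso)morphism.  HONEST LABEL:
  the sub-datum "length-0 chains only" — consistency of the interface, not the functor
  `Chain(X̃/X) → Chain(Π)` of a curve (FOUNDATIONS row 12 stays open for the genuine scheme side).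
* `AbsTopI.TargetData.nonempty_slim_prod_schemeChains` — the two together at the genuine instance.

No side taken on [IUTchIII] Cor 3.12; a witness is consistency evidence, not an endorsement; typed ≠
proved; model ≠ reconstruction.
-/

namespace Literature.AnabelianGeometry.AbsoluteAnabelian.AbsTopI

open _root_.CategoryTheory _root_.Topology
open Literature.AlgebraicGeometry.Frobenioids (IsSlimGroup)
open Literature.IUT.HodgeTheaters (profiniteCompletion)
open Literature.AnabelianGeometry.SemiGraphs (isSlimGroup_profiniteCompletion_freeGroupTwo
  isSlimGroup_prod_of_profinite)
open FundamentalExtension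

universe u

variable {E : FundamentalExtension.{u}}

/-! ### The exact criterion -/

/-- **[AbsTopI] Def 4.2 (iii) (0_Π)–(2_Π)** p. 49: the target binder package `TargetData F` is inhabited
iff `Π_F` is slim, `Δ_F` is slim and `Δ_F ≠ {1}` (cuspidal data on `F` always exist — e.g. none).
[cite: MochizukiAbsTopI2012, Def 4.2 (iii) p.49] -/
theorem TargetData.nonempty_iff (F : FundamentalExtension.{u}) :
    Nonempty (TargetData F) ↔ IsSlimGroup F.arith ∧ IsSlimGroup F.geom ∧ F.geom ≠ ⊥ := by
  constructor
  · rintro ⟨T⟩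
    exact ⟨T.hP, T.hΔ, T.hne⟩
  · rintro ⟨hP, hΔ, hne⟩
    obtain ⟨C⟩ := CuspidalData.nonempty_cuspless F
    exact ⟨⟨C, hP, hΔ, hne⟩⟩

/-- Any cuspidal data and the three slimness inputs give a `TargetData`.
[cite: MochizukiAbsTopI2012, Def 4.2 (iii) p.49] -/
theorem TargetData.nonempty_of (F : FundamentalExtension.{u}) (C : CuspidalData F)
    (hP : IsSlimGroup F.arith) (hΔ : IsSlimGroup F.geom) (hne : F.geom ≠ ⊥) :
    Nonempty (TargetData F) :=
  ⟨⟨C, hP, hΔ, hne⟩⟩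

/-! ### The scheme-side interface over the trivial chain -/

/-- **[AbsTopI] Rmk 4.2.1 p. 51 / Thm 4.7 (i) p. 57, interface inhabited** over every extension with
cuspidal data and slimness inputs: the one-object scheme side (the trivial `X̃/X`-chain `X`, length `0`)
sent to the trivial `Π`-chain `Π₀ = Π`, the identity being its only isomorphism / terminal
(iso)morphism.  Label «sub-datum: length-0 chains only». [cite: MochizukiAbsTopI2012, Rmk 4.2.1 p.51] -/
theorem SchemeChains.nonempty (C : CuspidalData E) (hP : IsSlimGroup E.arith)
    (hΔ : IsSlimGroup E.geom) (hne : E.geom ≠ ⊥) : Nonempty (SchemeChains E C hP hΔ hne) := by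
  classical
  -- the trivial `Π`-chain `Π₀ = Π` ([AbsTopI] Def 4.2 (iii) (0_Π))
  let c : E.PiChain C hP hΔ hne :=
    { len := 0
      term := fun _ => ChainGroup.self hP hΔ hne
      term_zero := rfl
      types := fun j => j.elim0
      isElemOp := fun j => j.elim0 }
  have hiso : PiChainIsoOver (Iso.refl E) c c :=
    ⟨rfl, fun j₁ _ _ => j₁.elim0, fun _ _ _ => ⟨selfIso (Iso.refl E) hP hΔ hne hP hΔ hne⟩⟩
  have hrange : Set.range (ContinuousMonoidHom.id c.last.grp) = Set.univ :=
    Set.eq_univ_of_forall fun x => ⟨x, rfl⟩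
  have hhom : c.HasTerminalHom c :=
    ⟨ContinuousMonoidHom.id _, 1, by rw [hrange]; exact isOpen_univ, fun x => by simp⟩
  have hisoT : c.HasTerminalIso c := ⟨ContinuousMulEquiv.refl _, 1, fun x => by simp⟩
  exact ⟨{ Obj := PUnit.{u + 1}
           toPiChain := fun _ => c
           ChainIso := fun _ _ => True
           HasTerminalMor := fun _ _ => True
           HasTerminalIso := fun _ _ => True
           map_iso := fun _ _ _ => hiso
           map_terminalMor := fun _ _ _ => hhom
           map_terminalIso := fun _ _ _ => hisoT }⟩

/-- Hence `SchemeChains` is inhabited wherever `TargetData` is. [cite: MochizukiAbsTopI2012, Rmk 4.2.1 p.51] -/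
theorem SchemeChains.nonempty_of_targetData (T : TargetData E) :
    Nonempty (SchemeChains E T.C T.hP T.hΔ T.hne) :=
  SchemeChains.nonempty T.C T.hP T.hΔ T.hne

/-! ### A genuine-in-group-theory instance: `Π := G_{ℚ_p} × F̂₂ ↠ G_{ℚ_p}` -/

/-- **[AbsTopI] Def 4.2 (iii) (0_Π)–(2_Π) jointly satisfied at `Π := G_{ℚ_p} × F̂₂ ↠ G := G_{ℚ_p}`**:
there is an extension `F` with `G_F = G_{ℚ_p}` (the tree's `absoluteGaloisGrp ℚ_[p]`),
`Π_F = G_{ℚ_p} × F̂₂`, augmentation the first projection, `Δ_F ≃ₜ* F̂₂`, `Π_F` slim ([pGC] Lem 15.8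
PROVED × `F̂₂` slim PROVED, product lemma), `Δ_F` slim and `≠ 1`, and hence `TargetData F` inhabited.
Honest label: a direct product, not `π₁` of a hyperbolic orbicurve. [cite: MochizukiAbsTopI2012, Def 4.2 (iii) p.49] -/
theorem TargetData.exists_slim_prod (p : ℕ) [Fact p.Prime] :
    ∃ F : FundamentalExtension.{0},
      F.gal = absoluteGaloisGrp ℚ_[p] ∧
      F.arith = ProfiniteGrp.of
        (absoluteGaloisGrp ℚ_[p] × profiniteCompletion (FreeGroup (Fin 2))) ∧
      Nonempty (F.geom ≃ₜ* profiniteCompletion (FreeGroup (Fin 2))) ∧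
      IsSlimGroup F.arith ∧ IsSlimGroup F.geom ∧ F.geom ≠ ⊥ ∧ Nonempty (TargetData F) := by
  classical
  let A : ProfiniteGrp.{0} := absoluteGaloisGrp ℚ_[p]
  let B : ProfiniteGrp.{0} := profiniteCompletion (FreeGroup (Fin 2))
  let F : FundamentalExtension.{0} :=
    { arith := ProfiniteGrp.of (A × B)
      gal := A
      aug := ContinuousMonoidHom.fst A B
      aug_surjective := fun a => ⟨(a, 1), rfl⟩ }
  have hmem : ∀ x : A × B, x ∈ F.geom ↔ x.1 = 1 := fun x => F.mem_geom
  -- `Δ = 1 × F̂₂ ≃ₜ* F̂₂`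
  let e : B ≃ₜ* F.geom :=
    { toFun := fun b => ⟨((1 : A), b), (hmem _).2 rfl⟩
      invFun := fun x => (x : A × B).2
      left_inv := fun _ => rfl
      right_inv := fun x => by
        apply Subtype.ext
        exact Prod.ext ((hmem x.1).1 x.2).symm rfl
      map_mul' := fun _ _ => rfl
      continuous_toFun := by
        apply Continuous.subtype_mk
        exact continuous_const.prodMk continuous_id
      continuous_invFun := continuous_snd.comp continuous_subtype_val }
  have hA : IsSlimGroup A := IsSubpadicFor.isSlimGroup_absoluteGaloisGroup (AbsTopIII.IsSubpadicFor.padic p)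
  have hB : IsSlimGroup B := isSlimGroup_profiniteCompletion_freeGroupTwo
  have hP : IsSlimGroup F.arith := isSlimGroup_prod_of_profinite hA hB
  have hΔ : IsSlimGroup F.geom := isSlimGroup_of_continuousMulEquiv e hB
  -- `Δ ≠ 1`: `η(a) ≠ 1` in `F̂₂` for the generator `a`, since its image in `Ẑ` under the completed
  -- exponent sum is `ι(1) ≠ ι(0)` (`toCompletion_int_injective`).
  have hne : F.geom ≠ ⊥ := by
    intro h
    -- the completed exponent sum `e₀ : F̂₂ → Ẑ` with `e₀ (η a) = ι (σ a)`
    let Zh : ProfiniteGrp.{0} := profiniteCompletion (Multiplicative ℤ)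
    let ι : Multiplicative ℤ →* Zh := Literature.IUT.HodgeTheaters.toCompletion (Multiplicative ℤ)
    let η : FreeGroup (Fin 2) →* B := Literature.IUT.HodgeTheaters.toCompletion (FreeGroup (Fin 2))
    let σ : FreeGroup (Fin 2) →* Multiplicative ℤ := FreeGroup.lift fun _ => Multiplicative.ofAdd (1 : ℤ)
    let e₀ : B →ₜ* Zh := (ProfiniteGrp.ProfiniteCompletion.lift (GrpCat.ofHom (ι.comp σ))).hom
    have he₀ : e₀ (η (FreeGroup.of 0)) = ι (σ (FreeGroup.of 0)) :=
      Literature.AnabelianGeometry.SemiGraphs.lift_hom_toCompletion Zh (ι.comp σ) (FreeGroup.of 0)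
    have hσ : σ (FreeGroup.of 0) = Multiplicative.ofAdd 1 := by simp [σ]
    have htriv : η (FreeGroup.of 0) = 1 := by
      have hx : (e (η (FreeGroup.of 0)) : F.arith) ∈ F.geom := (e (η (FreeGroup.of 0))).2
      have hx1 : ((e (η (FreeGroup.of 0)) : F.arith)) = 1 := Subgroup.mem_bot.mp (h.le hx)
      exact congrArg Prod.snd hx1
    have h1 : ι (Multiplicative.ofAdd 1) = 1 := by rw [← hσ, ← he₀, htriv, map_one]
    rw [← map_one ι] at h1
    exact absurd (Literature.IUT.HodgeTheaters.toCompletion_int_injective h1) (by decide)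
  refine ⟨F, rfl, rfl, ⟨e.symm⟩, hP, hΔ, hne, ?_⟩
  exact (TargetData.nonempty_iff F).2 ⟨hP, hΔ, hne⟩

/-- COROLLARY (the two census rows together at the genuine instance): over the extension of
`TargetData.exists_slim_prod`, both `TargetData` and `SchemeChains` (at that target's binders) are
inhabited. [cite: MochizukiAbsTopI2012, Thm 4.7 (i) p.57] -/
theorem TargetData.nonempty_slim_prod_schemeChains (p : ℕ) [Fact p.Prime] :
    ∃ F : FundamentalExtension.{0}, F.gal = absoluteGaloisGrp ℚ_[p] ∧
      ∃ T : TargetData F, Nonempty (SchemeChains F T.C T.hP T.hΔ T.hne) := by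
  obtain ⟨F, hgal, -, -, -, -, -, ⟨T⟩⟩ := TargetData.exists_slim_prod p
  exact ⟨F, hgal, T, SchemeChains.nonempty_of_targetData T⟩

end Literature.AnabelianGeometry.AbsoluteAnabelian.AbsTopI
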